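import Summits.Ventures.CertifiedManyBodySolver.Observables.StiffnessApexTransportFan
import HarnessLib

/-!
# Ventures/CertifiedManyBodySolver — Observables/StiffnessApexTransportFanTwoSided.lean

HONEST FRAMING: one-sided certified CEILINGS on the uniform flux stiffness (t–t′ f-sum class) at half filling, TRANSPORTED from ONE solved
source point to BOTH sides of its apex curve; conditional on the source rows named (f-sum orbit row + `K₂` ceiling on the source class); the
target side uses only the KINEMATIC `K₂` ceiling `16/π² ≤ 1.6211390` (or a named ceiling); a ceiling never speaks to the presence of order; not a
`T_c` estimate, not a superconductivity verdict; no phase sentence. Zero compute, no definition, no claim node, no `sorry`.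

Cell `pub/hubbard-downfold` (D-0150 L-DF2 «box ↦ one word»), seat `hubbard-downfold-unc-2` (`prover-hubbard-downfold-unc-2-g16-0`); companion of
`Observables/StiffnessApexTransportFan.lean` (the one-sided fan; separate file for the 400-line rule).

References: T. Koma, H. Tasaki, J. Stat. Phys. 76 (1994) 745, §1 [KomaTasaki1994]; D. J. Scalapino, S. R. White, S.-C. Zhang, PRB 47
(1993) 7995, §II [ScalapinoWhiteZhang1993]; E. H. Lieb, M. Loss, *Analysis* (AMS 2001, 2nd ed.) §8, Theorem 8.2 [LiebLoss1993].
-/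

noncomputable section

namespace Summit.Ventures.CertifiedManyBodySolver.Observables

open Literature.MathematicalPhysics.QuantumLattice
open Literature.MathematicalPhysics.QuantumLattice.ThermodynamicLimit
open Literature.MathematicalPhysics.QuantumFieldTheory
open Literature.Probability.LatticeModels
open Matrix Finset Filter Topology HubbardWave0
open scoped Matrix BigOperators ComplexOrder

/-! ## §1 The TWO-SIDED fan: LEFT of the apex curve a `K₂` ceiling on the TARGET class pays — and the kinematic one is always there

Left of the curve (`κ > 2t′_P`) the target-end identity `e_{2t′_P}(ω_P) = e_κ(ω_P) + (2t′_P − κ)K₂(ω_P)` needs an UPPER bound on `K₂(ω_P)`: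
`−¼e_{2t′_P}(ω_P) ≤ −¼e_κ(ω_P) + (κ − 2t′_P)·A_P/4`. No certificate at the target is needed for `A_P = 1.6211390 ≥ 16/π²`
(`IsTorusLimitOf.abs_meanEnergy_diagHop_le_decimal`): near the curve `κ − 2t′_P` is small, so ONE point words a band on BOTH sides of its
curve: `c ≥ −r + max(2t′_A − κ, 0)·A/4 + max(κ − 2t′_P, 0)·A_P/4`. On a rectangle `[t₁, t₂] × [U₁, U₂]` with `t′_A ≤ t₁`, `t₂ < 0`, `U_A < U₁`
the first hinge is largest at `(t₂, U₁)` and the second at `(t₁, U₂)` (`κ` decreases in `t′` and, for `t′ ≥ t′_A`, increases in `U`), so a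
rectangle is worded by ONE decidable inequality (`…_on_rect_…`). -/

section TwoSided

variable {t'A UA : ℝ}

/-- **The kinematic `K₂` ceiling on every class**: `K₂(ω) ≤ 1.6211390` for every torus limit of normalised `(rectN n, S^z = 0)`-sector ground states,
`0 ≤ n < 2`, any `(t′, U)`. [cite: LiebLoss1993, §8, Theorem 8.2] -/
theorem forall_torusLimit_diagHop_le_kinematic (t' U : ℝ) {n : ℝ} (hn0 : 0 ≤ n) (hn2 : n < 2) :
    ∀ (ω : InfVolFermionState 2) (Ls : ℕ → ℕ) (ψ : ∀ L, Fock (Orb (FermionTorus 2 L))),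
      Tendsto Ls atTop atTop →
      (∀ j, IsGroundStateInSector (hubbardTorusTT' (Ls j) 1 t' U) (rectN n (Ls j)) 0 (ψ (Ls j))) →
      (∀ j, star (ψ (Ls j)) ⬝ᵥ ψ (Ls j) = 1) → ω.IsTorusLimitOf ψ Ls →
      ω.meanEnergy (hubbardTTPrimeFermionInteraction 0 1 0) 1 ≤ (1.6211390 : ℝ) := by
  intro ω Ls ψ hLs hψ h1 hω
  have hN : ∀ j, IsNParticle (rectN n (Ls j)) (ψ (Ls j)) := fun j => ((mem_szSector_iff _ _ _).1 (hψ j).1).1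
  exact (abs_le.1 (hω.abs_meanEnergy_diagHop_le_decimal hn0 hn2 hLs hN h1)).2

/-- **THE TWO-SIDED FAN (half filling, `t′_A < 0`).** A certified f-sum orbit row `r` at the source `(t′_A, U_A, 1)` (`U_A ≥ 0`, cap certified), a
ceiling `K₂ ≤ A` (`A ≥ 0`) on the source class and a ceiling `K₂ ≤ A_P` (`A_P ≥ 0`) on the TARGET class `(t′_P, U_P, 1)` give, for EVERY target
with `U_A < U_P` and `t′_P < 0` (either side of the apex curve), `ObsStiffnessSeqCeilingAt t′_P U_P 1 c` for every
`c ≥ −r + max(2t′_A − κ, 0)·A/4 + max(κ − 2t′_P, 0)·A_P/4`, `κ = (U_P t′_A − U_A t′_P)/(U_P − U_A)`.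
[cite: KomaTasaki1994, §1] [cite: ScalapinoWhiteZhang1993, §II] -/
theorem ObsStiffnessSeqCeilingAt_halfFilling_on_apexTwoSidedFan_of_fsumRow (Uo : ℝ) (hUA : 0 ≤ UA) (ht'A : t'A < 0) {u r : ℚ}
    (hrow : SquareTTPrimeCorrOrbitLowerRow t'A UA 1 u r Finset.univ (box 2 7) (-oddMomentObsTT t'A Uo 0))
    (hu : energyDensityTT' 1 t'A UA 1 ≤ ((u : ℚ) : ℝ)) {A : ℝ} (hA0 : 0 ≤ A)
    (hA : ∀ (ω : InfVolFermionState 2) (Ls : ℕ → ℕ) (ψ : ∀ L, Fock (Orb (FermionTorus 2 L))),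
      Tendsto Ls atTop atTop →
      (∀ j, IsGroundStateInSector (hubbardTorusTT' (Ls j) 1 t'A UA) (rectN 1 (Ls j)) 0 (ψ (Ls j))) →
      (∀ j, star (ψ (Ls j)) ⬝ᵥ ψ (Ls j) = 1) → ω.IsTorusLimitOf ψ Ls →
      ω.meanEnergy (hubbardTTPrimeFermionInteraction 0 1 0) 1 ≤ A)
    {t'P UP : ℝ} {AP : ℝ} (hAP0 : 0 ≤ AP)
    (hAP : ∀ (ω : InfVolFermionState 2) (Ls : ℕ → ℕ) (ψ : ∀ L, Fock (Orb (FermionTorus 2 L))),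
      Tendsto Ls atTop atTop →
      (∀ j, IsGroundStateInSector (hubbardTorusTT' (Ls j) 1 t'P UP) (rectN 1 (Ls j)) 0 (ψ (Ls j))) →
      (∀ j, star (ψ (Ls j)) ⬝ᵥ ψ (Ls j) = 1) → ω.IsTorusLimitOf ψ Ls →
      ω.meanEnergy (hubbardTTPrimeFermionInteraction 0 1 0) 1 ≤ AP)
    (hU : UA < UP) (ht'P : t'P < 0) (c : ℚ)
    (hc : -((r : ℚ) : ℝ) + max (2 * t'A - (UP * t'A - UA * t'P) / (UP - UA)) 0 * A / 4 +
      max ((UP * t'A - UA * t'P) / (UP - UA) - 2 * t'P) 0 * AP / 4 ≤ ((c : ℚ) : ℝ)) :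
    ObsStiffnessSeqCeilingAt t'P UP 1 c := by
  have hd : 0 < UP - UA := sub_pos.2 hU
  set κ : ℝ := (UP * t'A - UA * t'P) / (UP - UA) with hκ_def
  have hmA : 0 ≤ max (2 * t'A - κ) 0 * A / 4 := div_nonneg (mul_nonneg (le_max_right _ _) hA0) (by norm_num)
  have hmP : 0 ≤ max (κ - 2 * t'P) 0 * AP / 4 := div_nonneg (mul_nonneg (le_max_right _ _) hAP0) (by norm_num)
  intro ρs θ₀ _ hθ₀ Ls hLs hst
  refine (fluxStiffness_le_of_torusLimitTT'_oddMoment_orbit_certificate_seq t'P (U := UP) (δ := 1 - 1) (q := ((c : ℚ) : ℝ)) 0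
    Finset.univ Finset.univ_nonempty (by norm_num) (by norm_num) hθ₀ hLs hst ?_)
  intro ω Ms ψ hMs hψ h1 hω
  have hψ' : ∀ j, IsGroundStateInSector (hubbardTorusTT' (Ms j) 1 t'P UP) (rectN 1 (Ms j)) 0 (ψ (Ms j)) := fun j => by
    simpa only [sub_sub_cancel] using hψ j
  rw [orbitMean_rotOddMomentLimitFunctionalTT_lam_zero_eq_meanEnergy_twice_tPrime hω.isTranslationInvariant]
  obtain ⟨ψA, φ, ωA, hφ, hψA, hψA1, hωA, -, -, -⟩ :=
    exists_isTorusLimitOf_sectorGroundState_TT' 1 t'A UA zero_le_one one_le_two (Ls := id) tendsto_id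
  have hLφ : Tendsto (id ∘ φ : ℕ → ℕ) atTop atTop := tendsto_id.comp hφ.tendsto_atTop
  -- apex row: `e_κ(ω_A) ≤ e_κ(ω_P)`
  have hapx := InfVolFermionState.IsTorusLimitOf.meanEnergy_apexHopping_le_of_groundStates 1 t'A t'P hUA hU zero_le_one
    one_lt_two hωA hLφ (fun j => hψA _) (fun j => hψA1 _) hω hMs hψ' h1
  simp only [← hκ_def] at hapx
  -- target end, hinge form: `e_κ(ω_P) ≤ e_{2t′_P}(ω_P) + max(κ − 2t′_P, 0)·A_P`
  have htgt : ω.meanEnergy (hubbardTTPrimeFermionInteraction 1 κ 0) 1 ≤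
      ω.meanEnergy (hubbardTTPrimeFermionInteraction 1 (2 * t'P) 0) 1 + max (κ - 2 * t'P) 0 * AP := by
    rcases le_total κ (2 * t'P) with hle | hge
    · have hcP : 0 ≤ (κ - 2 * t'P) / t'P := div_nonneg_of_nonpos (by linarith) ht'P.le
      have heP : κ - 2 * t'P = (κ - 2 * t'P) / t'P * t'P := by rw [div_mul_cancel₀ _ ht'P.ne]
      have h := InfVolFermionState.IsTorusLimitOf.meanEnergy_oneBody_anti_hopping_of_groundState_halfFilling 1 t'P
        (hUA.trans hU.le) hω hMs hψ' h1 (κ := 2 * t'P) (κ' := κ) hcP heP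
      nlinarith [mul_nonneg (le_max_right (κ - 2 * t'P) 0) hAP0]
    · have h := InfVolFermionState.meanEnergy_hopping_le_add_mul_of_diagHop_le ω 1 (κ := 2 * t'P) (κ' := κ) hge
        (hAP ω Ms ψ hMs hψ' h1 hω)
      have hm : (κ - 2 * t'P) * AP ≤ max (κ - 2 * t'P) 0 * AP := mul_le_mul_of_nonneg_right (le_max_left _ _) hAP0
      linarith
  -- source end, hinge form: `e_{2t′_A}(ω_A) ≤ e_κ(ω_A) + max(2t′_A − κ, 0)·A`
  have hsrc : ωA.meanEnergy (hubbardTTPrimeFermionInteraction 1 (2 * t'A) 0) 1 ≤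
      ωA.meanEnergy (hubbardTTPrimeFermionInteraction 1 κ 0) 1 + max (2 * t'A - κ) 0 * A := by
    rcases le_total κ (2 * t'A) with hle | hge
    · have h := InfVolFermionState.meanEnergy_hopping_le_add_mul_of_diagHop_le ωA 1 (κ := κ) (κ' := 2 * t'A) hle
        (hA ωA (id ∘ φ) ψA hLφ (fun j => hψA _) (fun j => hψA1 _) hωA)
      have hm : (2 * t'A - κ) * A ≤ max (2 * t'A - κ) 0 * A := mul_le_mul_of_nonneg_right (le_max_left _ _) hA0
      linarith
    · have hcA : 0 ≤ (2 * t'A - κ) / t'A := div_nonneg_of_nonpos (by linarith) ht'A.le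
      have heA : 2 * t'A - κ = (2 * t'A - κ) / t'A * t'A := by rw [div_mul_cancel₀ _ ht'A.ne]
      have h := InfVolFermionState.IsTorusLimitOf.meanEnergy_oneBody_anti_hopping_of_groundState_halfFilling 1 t'A hUA hωA
        hLφ (fun j => hψA _) (fun j => hψA1 _) (κ := κ) (κ' := 2 * t'A) hcA heA
      nlinarith [mul_nonneg (le_max_right (2 * t'A - κ) 0) hA0]
  have hv := hrow ωA (id ∘ φ) ψA hLφ (fun j => hψA _) (fun j => hψA1 _) hωA hu
  rw [orbitMean_re_expect_neg_oddMomentTT_lam_zero hωA.isTranslationInvariant] at hv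
  linarith

/-- **Two-sided fan, KINEMATIC target ceiling** (`A_P = 1.6211390`, no word on the target class): every target with `U_A < U_P`, `t′_P < 0` and
`c ≥ −r + max(2t′_A − κ, 0)·A/4 + max(κ − 2t′_P, 0)·1.6211390/4`. [cite: KomaTasaki1994, §1] [cite: LiebLoss1993, §8, Theorem 8.2] -/
theorem ObsStiffnessSeqCeilingAt_halfFilling_on_apexTwoSidedFan_of_fsumRow_kinematicTarget (Uo : ℝ) (hUA : 0 ≤ UA) (ht'A : t'A < 0)
    {u r : ℚ} (hrow : SquareTTPrimeCorrOrbitLowerRow t'A UA 1 u r Finset.univ (box 2 7) (-oddMomentObsTT t'A Uo 0))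
    (hu : energyDensityTT' 1 t'A UA 1 ≤ ((u : ℚ) : ℝ)) {A : ℝ} (hA0 : 0 ≤ A)
    (hA : ∀ (ω : InfVolFermionState 2) (Ls : ℕ → ℕ) (ψ : ∀ L, Fock (Orb (FermionTorus 2 L))),
      Tendsto Ls atTop atTop →
      (∀ j, IsGroundStateInSector (hubbardTorusTT' (Ls j) 1 t'A UA) (rectN 1 (Ls j)) 0 (ψ (Ls j))) →
      (∀ j, star (ψ (Ls j)) ⬝ᵥ ψ (Ls j) = 1) → ω.IsTorusLimitOf ψ Ls →
      ω.meanEnergy (hubbardTTPrimeFermionInteraction 0 1 0) 1 ≤ A)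
    {t'P UP : ℝ} (hU : UA < UP) (ht'P : t'P < 0) (c : ℚ)
    (hc : -((r : ℚ) : ℝ) + max (2 * t'A - (UP * t'A - UA * t'P) / (UP - UA)) 0 * A / 4 +
      max ((UP * t'A - UA * t'P) / (UP - UA) - 2 * t'P) 0 * 1.6211390 / 4 ≤ ((c : ℚ) : ℝ)) :
    ObsStiffnessSeqCeilingAt t'P UP 1 c :=
  ObsStiffnessSeqCeilingAt_halfFilling_on_apexTwoSidedFan_of_fsumRow Uo hUA ht'A hrow hu hA0 hA (by norm_num)
    (forall_torusLimit_diagHop_le_kinematic t'P UP zero_le_one one_lt_two) hU ht'P c hc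

/-- **`κ` is smallest at the corner `(t₂, U₁)` of a rectangle** (`U_A ≥ 0`, `U_A < U₁ ≤ U`, `t ≤ t₂`, `t′_A ≤ t₂`):
`κ(t₂, U₁) ≤ κ(t, U)`. [folklore] -/
theorem apexFan_kappa_corner_le {t U t₂ U₁ : ℝ} (hUA : 0 ≤ UA) (hU₁ : UA < U₁) (hU : U₁ ≤ U) (ht : t ≤ t₂) (ht'A : t'A ≤ t₂) :
    (U₁ * t'A - UA * t₂) / (U₁ - UA) ≤ (U * t'A - UA * t) / (U - UA) := by
  have h1 : 0 < U₁ - UA := sub_pos.2 hU₁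
  have h2 : 0 < U - UA := by linarith
  rw [div_le_div_iff₀ h1 h2]
  nlinarith [mul_nonneg hUA (mul_nonneg (sub_nonneg.2 hU) (sub_nonneg.2 ht'A)),
    mul_nonneg hUA (mul_nonneg h1.le (sub_nonneg.2 ht))]

/-- **`κ − 2t′` is largest at the corner `(t₁, U₂)` of a rectangle** (`U_A ≥ 0`, `U_A < U ≤ U₂`, `t₁ ≤ t`, `t′_A ≤ t₁`):
`κ(t, U) − 2t ≤ κ(t₁, U₂) − 2t₁`. [folklore] -/
theorem apexFan_kappa_sub_corner_le {t U t₁ U₂ : ℝ} (hUA : 0 ≤ UA) (hUAU : UA < U) (hU : U ≤ U₂) (ht : t₁ ≤ t) (ht'A : t'A ≤ t₁) :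
    (U * t'A - UA * t) / (U - UA) - 2 * t ≤ (U₂ * t'A - UA * t₁) / (U₂ - UA) - 2 * t₁ := by
  have h1 : 0 < U - UA := sub_pos.2 hUAU
  have h2 : 0 < U₂ - UA := by linarith
  have hκt : (U * t'A - UA * t) / (U - UA) ≤ (U * t'A - UA * t₁) / (U - UA) :=
    div_le_div_of_nonneg_right (by nlinarith [mul_nonneg hUA (sub_nonneg.2 ht)]) h1.le
  have hκU : (U * t'A - UA * t₁) / (U - UA) ≤ (U₂ * t'A - UA * t₁) / (U₂ - UA) := by
    rw [div_le_div_iff₀ h1 h2]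
    nlinarith [mul_nonneg hUA (mul_nonneg (sub_nonneg.2 hU) (sub_nonneg.2 ht'A))]
  linarith

/-- **ONE POINT WORDS A RECTANGLE by one decidable inequality** (half filling, `t′_A < 0`; decimal source words `−r ≤ w`, `A ≤ a`, kinematic target
ceiling): for `[t₁, t₂] × [U₁, U₂]` with `t′_A ≤ t₁`, `t₂ < 0`, `U_A < U₁` and
`c ≥ w + max(2t′_A − κ(t₂, U₁), 0)·a/4 + max(κ(t₁, U₂) − 2t₁, 0)·1.6211390/4`, `ObsStiffnessSeqCeilingAt tp U 1 c` at every point of the rectangle.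
[cite: KomaTasaki1994, §1] [cite: ScalapinoWhiteZhang1993, §II] -/
theorem ObsStiffnessSeqCeilingAt_halfFilling_on_rect_of_fsumRow_kinematicTarget (Uo : ℝ) (hUA : 0 ≤ UA) (ht'A : t'A < 0) {u r : ℚ}
    (hrow : SquareTTPrimeCorrOrbitLowerRow t'A UA 1 u r Finset.univ (box 2 7) (-oddMomentObsTT t'A Uo 0))
    (hu : energyDensityTT' 1 t'A UA 1 ≤ ((u : ℚ) : ℝ)) {A : ℝ} (hA0 : 0 ≤ A)
    (hA : ∀ (ω : InfVolFermionState 2) (Ls : ℕ → ℕ) (ψ : ∀ L, Fock (Orb (FermionTorus 2 L))),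
      Tendsto Ls atTop atTop →
      (∀ j, IsGroundStateInSector (hubbardTorusTT' (Ls j) 1 t'A UA) (rectN 1 (Ls j)) 0 (ψ (Ls j))) →
      (∀ j, star (ψ (Ls j)) ⬝ᵥ ψ (Ls j) = 1) → ω.IsTorusLimitOf ψ Ls →
      ω.meanEnergy (hubbardTTPrimeFermionInteraction 0 1 0) 1 ≤ A)
    {w a : ℝ} (hw : -((r : ℚ) : ℝ) ≤ w) (ha : A ≤ a) {t₁ t₂ U₁ U₂ : ℝ} (ht₁ : t'A ≤ t₁) (ht₂ : t₂ < 0) (hU₁ : UA < U₁) (c : ℚ)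
    (hc : w + max (2 * t'A - (U₁ * t'A - UA * t₂) / (U₁ - UA)) 0 * a / 4 +
      max ((U₂ * t'A - UA * t₁) / (U₂ - UA) - 2 * t₁) 0 * 1.6211390 / 4 ≤ ((c : ℚ) : ℝ)) :
    ∀ tp ∈ Set.Icc t₁ t₂, ∀ U ∈ Set.Icc U₁ U₂, ObsStiffnessSeqCeilingAt tp U 1 c := by
  intro tp htp U hU
  have ha0 : 0 ≤ a := hA0.trans ha
  refine ObsStiffnessSeqCeilingAt_halfFilling_on_apexTwoSidedFan_of_fsumRow_kinematicTarget Uo hUA ht'A hrow hu hA0 hA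
    (by linarith [hU.1]) (by linarith [htp.2]) c ?_
  have h₁ : max (2 * t'A - (U * t'A - UA * tp) / (U - UA)) 0 ≤ max (2 * t'A - (U₁ * t'A - UA * t₂) / (U₁ - UA)) 0 :=
    max_le_max (by linarith [apexFan_kappa_corner_le hUA hU₁ hU.1 htp.2 (ht₁.trans (htp.1.trans htp.2))]) le_rfl
  have h₂ : max ((U * t'A - UA * tp) / (U - UA) - 2 * tp) 0 ≤ max ((U₂ * t'A - UA * t₁) / (U₂ - UA) - 2 * t₁) 0 :=
    max_le_max (apexFan_kappa_sub_corner_le hUA (by linarith [hU.1]) hU.2 htp.1 ht₁) le_rfl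
  have hm₁ : 0 ≤ max (2 * t'A - (U * t'A - UA * tp) / (U - UA)) 0 := le_max_right _ _
  have e₁ : max (2 * t'A - (U * t'A - UA * tp) / (U - UA)) 0 * A / 4 ≤
      max (2 * t'A - (U₁ * t'A - UA * t₂) / (U₁ - UA)) 0 * a / 4 :=
    div_le_div_of_nonneg_right ((mul_le_mul_of_nonneg_left ha hm₁).trans (mul_le_mul_of_nonneg_right h₁ ha0)) (by norm_num)
  have e₂ : max ((U * t'A - UA * tp) / (U - UA) - 2 * tp) 0 * 1.6211390 / 4 ≤
      max ((U₂ * t'A - UA * t₁) / (U₂ - UA) - 2 * t₁) 0 * 1.6211390 / 4 :=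
    div_le_div_of_nonneg_right (mul_le_mul_of_nonneg_right h₂ (by norm_num)) (by norm_num)
  linarith

end TwoSided

end Summit.Ventures.CertifiedManyBodySolver.Observables

end
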